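import Literature.MathematicalPhysics.QuantumFieldTheory.Dimock2011to13.QED3CorridorSeparation
import Literature.MathematicalPhysics.QuantumFieldTheory.Dimock2011to13.QED3ScaledPathMetric
import HarnessLib

/-!
# Dimock, *QED on the 3-torus. II*, §3.2 proof of LEMMA 2 Part III (177)
# `d_{Ω(□)}(x,y) ≥ O(1)L^{(k−i)}d(x,y) ≥ O(1)d_Λ(x,y)` on `□^{(5)} ⊂ δΛ^{(k)}_i ∪ δΛ^{(k)}_{i+1}` — BOTH comparisons of
# the long-distance metric `d_Λ` (127) with the lattice distance around a `D_i` block, with the `O(1)`'s explicit,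
# ASSEMBLED from the tree's corridor separation ((92) ⟹ p.27 L61–62) and concrete `d_Λ`

statement-level skeleton of published theorems with citation tags; proofs where landed; nothing here is a claim about the Yang–Mills mass gap

**Citation header (reproduction of PUBLISHED work).** J. Dimock, *Quantum electrodynamics on the 3-torus. II*,
arXiv:math-ph/0407063 [Dimock2004QED3TorusII], **§3.1** (121)–(123) p.20 L42–69, (127) p.21 L16–23, **§3.2** proof of
LEMMA 2 Part III (176)–(177) p.27 L55–65, proof of THEOREM 1 Part III p.24 L59–62, of the held arXiv text layer
`paper:arxiv-math-ph_0407063` (`p.NN Lnn` = PDF page ∕ text-layer line).  Writer seat p11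
(literature-prover-lit-balaban-p11-g23-0), YM LIT SWEEP item (c) D13 (row C13 «WHERE»; zero weight for the YM-INPRINT
tokens).  Imports the tree's `QED3CorridorSeparation` ((92), the layers, `window_subset_layers_deep ∕ _shallow`) and
`QED3ScaledPathMetric` ((127) as `dLambda`, `dLambda_local_lower`, `dLambda_le_box`).

**The printed text.** (176)–(177) p.27 L55–65: *"… `|S*_□(0,x,y)| ≤ O(d′(x,y)^{−2})exp(−O(1)d_{Ω(□)}(x,y))` (176)  Now
consider `x, y ∈ L^{−k}Ω_0(□) ⊂ □^{(5)}`.  Assuming `5r_1 < r_0` we have `□^{(5)} ⊂ δΛ^{(k)}_i ∪ δΛ^{(k)}_{i+1}`.  Then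
`d_{Ω(□)}(x,y) ≥ O(1)L^{(k−i)}d(x,y) ≥ O(1)d_Λ(x,y)` (177) and we have the result (137) we need."*  p.21 L23: *"This is a
genuine metric which weighs earlier regions more heavily."*

**What is formalized (kernel-checked, zero `sorry`).**  In the index coordinates of `QED3BlockingGeometry` (`L = 2a+1`,
sites `ι → ℤ`, layers `B_lδΛ_l = blockUpIter a l (deltaRegion a Λ l)`, `l = 1, …, k`, partitioning `Λ_0` by (121)):
* **`layerIndex a Λ k z`** — the scale `i` of the layer `δΛ^{(k)}_i ∋ z` (the `sup` of the indices of the layers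
  containing `z`; `layerIndex_eq_of_mem`: `= l` on `B_lδΛ_l`, by the disjointness (121)); with it Dimock's (127) is the
  tree's `dLambda η L k (layerIndex a Λ k)` (`η` the lattice spacing, `L^{−k}` in the paper), abbreviated `dLam`.
* **(177) for the unsubdivided blocks of `D_i`** — `dimock177_deep`: for `x ∈ B_iδΛ_i` with a deep `L^i`-cube index
  (depth `ϱ₀ = r_0M_0`), the corridor (92) at level `i+1` (`ϱ = rM_0`), a window `W ≤ ϱ₀L^i`, `W ≤ (ϱ−1)L^{i+1}`, and any
  `y` with `|y_μ − x_μ| ≤ W ∀μ`: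
  `(η∕2)·L^{k−(i+1)}·min(supDist x y, W) ≤ d_Λ(x,y) ≤ η·L^{k−i}·supDist x y`.
  The right inequality is the printed second `≥` of (177) (`O(1) = 1`); the left one is the quantitative form of *"weighs
  earlier regions more heavily"* on `□^{(5)} ⊂ δΛ_i ∪ δΛ_{i+1}` (weights `≥ ηL^{k−i−1}` there), which together with
  `d_{Ω(□)} ≥ d_Λ`-type comparisons is how the first `≥` of (177) is used; `d_{Ω(□)}` itself (the metric of the local
  region `Ω(□)`, (156)–(160)) is not constructed here.
* **(177) for the subdivided boundary blocks of `D_i`** — `dimock177_shallow`: the same two inequalities for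
  `x ∈ B_{i+1}δΛ_{i+1}` with a shallow `L^{i+1}`-cube index, corridors at `i` and `i+1`, `W ≤ (ϱ−1)L^i`,
  `W ≤ (ϱ−ϱ₀−1)L^{i+1}`.
* the two one-sided statements separately (`dLam_upper_of_window`, `dLam_lower_of_window`) from a WINDOW HYPOTHESIS
  alone (every `z` with `|z_μ − x_μ| ≤ W` lies in `B_iδΛ_i ∪ B_{i+1}δΛ_{i+1}`), which is what `window_subset_layers_deep ∕
  _shallow` deliver.

**Honest scope.** Lattice discretisation and conventions as in `QED3ScaledPathMetric` (king walks, sup-norm steps,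
half–half charging, no torus identification); the `O(1)`'s are those of that discretisation.  Sites outside `Λ_0` get
`layerIndex = 0` (weight `ηL^k`); they do not occur in the windows considered (by `window_subset_layers_*`).  Not here:
`d_{Ω(□)}`, `Ω(□)`, (176), (137).  No named facts are introduced.
-/

namespace Literature.MathematicalPhysics.QuantumFieldTheory.Dimock2011to13

namespace QED3TorusII

open Finset QED3PathMetric

variable {ι : Type*} [Fintype ι] [DecidableEq ι]

/-! ## §1 The layer index of a site -/

/-- **The scale of a site**: `layerIndex a Λ k z = i` when `z ∈ δΛ^{(k)}_i = B_iδΛ_i` (`1 ≤ i ≤ k`; the layers are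
disjoint by (121)), and `0` for sites in no layer. [cite: Dimock2004QED3TorusII, §3.1 (121) p.20 L42–48, (127) p.21 L16–23] -/
noncomputable def layerIndex (a : ℕ) (Λ : ℕ → Finset (ι → ℤ)) (k : ℕ) (z : ι → ℤ) : ℕ :=
  ((range (k + 1)).filter fun l => 1 ≤ l ∧ z ∈ blockUpIter a l (deltaRegion a Λ l)).sup id

/-- on the layer `B_lδΛ_l` the index is `l`. [cite: Dimock2004QED3TorusII, §3.1 (121) p.20 L42–48 («the disjoint union»)] -/
theorem layerIndex_eq_of_mem {a : ℕ} {Λ : ℕ → Finset (ι → ℤ)} {k : ℕ} (hblock : ∀ j < k, IsBlockUnion a (Λ j))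
    (hdec : ∀ j < k, Λ (j + 1) ⊆ unblock a (Λ j)) {l : ℕ} (hl1 : 1 ≤ l) (hlk : l ≤ k) {z : ι → ℤ}
    (hz : z ∈ blockUpIter a l (deltaRegion a Λ l)) : layerIndex a Λ k z = l := by
  unfold layerIndex
  apply le_antisymm
  · refine Finset.sup_le fun l' hl' => ?_
    rw [mem_filter, mem_range] at hl'
    by_contra hne
    have hlt : l < l' := by simpa using hne
    have hdis := eq121_disjoint a Λ k hblock hdec hl1 hlt (by omega)
    exact Finset.disjoint_left.1 hdis hz hl'.2.2
  · exact Finset.le_sup (f := id) (mem_filter.2 ⟨mem_range.2 (by omega), hl1, hz⟩)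

/-- in a two-layer window the index is `i` or `i+1`. [cite: Dimock2004QED3TorusII, §3.2 p.27 L61–62] -/
theorem layerIndex_mem_pair {a : ℕ} {Λ : ℕ → Finset (ι → ℤ)} {k : ℕ} (hblock : ∀ j < k, IsBlockUnion a (Λ j))
    (hdec : ∀ j < k, Λ (j + 1) ⊆ unblock a (Λ j)) {i : ℕ} (hi1 : 1 ≤ i) (hik : i + 1 ≤ k) {z : ι → ℤ}
    (hz : z ∈ blockUpIter a i (deltaRegion a Λ i) ∨ z ∈ blockUpIter a (i + 1) (deltaRegion a Λ (i + 1))) :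
    layerIndex a Λ k z = i ∨ layerIndex a Λ k z = i + 1 := by
  rcases hz with h | h
  · exact Or.inl (layerIndex_eq_of_mem hblock hdec hi1 (by omega) h)
  · exact Or.inr (layerIndex_eq_of_mem hblock hdec (by omega) hik h)

/-! ## §2 `d_Λ` with the layer index as scale; the two comparisons from a window hypothesis -/

/-- **Dimock's `d_Λ` (127) on the regions `Λ`**: the tree's `dLambda` with spacing `η`, ratio `L = 2a+1` and the layer
index as scale. [cite: Dimock2004QED3TorusII, §3.1 (127) p.21 L16–23] -/
noncomputable def dLam (η : ℝ) (a : ℕ) (Λ : ℕ → Finset (ι → ℤ)) (k : ℕ) (x y : ι → ℤ) : ℝ :=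
  dLambda η (2 * a + 1 : ℝ) k (layerIndex a Λ k) x y

section Window

variable {η : ℝ} {a : ℕ} {Λ : ℕ → Finset (ι → ℤ)} {k : ℕ}

omit [DecidableEq ι] in
/-- sup-distance `≤ W` in the tree's `supDist` is the window condition `|z_μ − x_μ| ≤ W ∀μ`.
[cite: Dimock2004QED3TorusII, §3.1 (126)–(127) p.21 L11–23] -/
theorem supDist_le_iff_abs {z x : ι → ℤ} {W : ℕ} : supDist z x ≤ W ↔ ∀ μ, |z μ - x μ| ≤ (W : ℤ) := by
  rw [supDist_le_iff]
  refine forall_congr' fun μ => ?_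
  have := Int.abs_eq_natAbs (z μ - x μ)
  omega

/-- **Upper comparison from a window** (the second `≥` of (177)): if every `z` with `|z_μ − x_μ| ≤ W` lies in
`B_iδΛ_i ∪ B_{i+1}δΛ_{i+1}` (`1 ≤ i`, `i+1 ≤ k`), then for `y` in that window
`d_Λ(x,y) ≤ η·L^{k−i}·supDist x y` (`0 ≤ η`). [cite: Dimock2004QED3TorusII, §3.2 proof of Lemma 2 Part III (177) p.27 L61–65] -/
theorem dLam_upper_of_window (hblock : ∀ j < k, IsBlockUnion a (Λ j))
    (hdec : ∀ j < k, Λ (j + 1) ⊆ unblock a (Λ j)) {i : ℕ} (hi1 : 1 ≤ i) (hik : i + 1 ≤ k) (hη : 0 ≤ η)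
    {x : ι → ℤ} {W : ℕ}
    (hwin : ∀ z : ι → ℤ, (∀ μ, |z μ - x μ| ≤ (W : ℤ)) →
      z ∈ blockUpIter a i (deltaRegion a Λ i) ∨ z ∈ blockUpIter a (i + 1) (deltaRegion a Λ (i + 1)))
    {y : ι → ℤ} (hy : ∀ μ, |y μ - x μ| ≤ (W : ℤ)) :
    dLam η a Λ k x y ≤ η * (2 * a + 1 : ℝ) ^ (k - i) * supDist x y := by
  unfold dLam
  refine dLambda_le_box hη (by norm_cast; omega) fun u hu => ?_
  have hu' : ∀ μ, |u μ - x μ| ≤ (W : ℤ) := by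
    intro μ
    have h1 := hu μ
    have h2 := hy μ
    rw [abs_le] at h2 ⊢
    constructor <;> omega
  rcases layerIndex_mem_pair hblock hdec hi1 hik (hwin u hu') with h | h <;> omega

/-- **Lower comparison from a window** (*"weighs earlier regions more heavily"*, on the window the weights are
`≥ ηL^{k−(i+1)}`): under the same window hypothesis, for EVERY `y`,
`(η∕2)·L^{k−(i+1)}·min(supDist x y, W) ≤ d_Λ(x,y)`.
[cite: Dimock2004QED3TorusII, §3.2 proof of Lemma 2 Part III (177) p.27 L61–65; §3.1 (127) p.21 L23] -/
theorem dLam_lower_of_window (hblock : ∀ j < k, IsBlockUnion a (Λ j))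
    (hdec : ∀ j < k, Λ (j + 1) ⊆ unblock a (Λ j)) {i : ℕ} (hi1 : 1 ≤ i) (hik : i + 1 ≤ k) (hη : 0 ≤ η)
    {x : ι → ℤ} {W : ℕ}
    (hwin : ∀ z : ι → ℤ, (∀ μ, |z μ - x μ| ≤ (W : ℤ)) →
      z ∈ blockUpIter a i (deltaRegion a Λ i) ∨ z ∈ blockUpIter a (i + 1) (deltaRegion a Λ (i + 1)))
    (y : ι → ℤ) :
    η * (2 * a + 1 : ℝ) ^ (k - (i + 1)) / 2 * ((min (supDist x y) W : ℕ) : ℝ) ≤ dLam η a Λ k x y := by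
  unfold dLam
  refine dLambda_local_lower hη (by norm_cast; omega) W (fun u hu => ?_) y
  rcases layerIndex_mem_pair hblock hdec hi1 hik (hwin u (supDist_le_iff_abs.1 hu)) with h | h <;> omega

end Window

/-! ## §3 (177) around the two kinds of `D_i` blocks -/

section Dimock177

variable {η : ℝ} {a ϱ ϱ₀ : ℕ} {Λ : ℕ → Finset (ι → ℤ)} {k : ℕ}

/-- **(177), unsubdivided blocks of `D_i`.**  Regions (90)–(91) as block unions with `Λ_k = ∅`, the corridor (92) at
level `i+1` (`ϱ = rM_0`), `x ∈ δΛ^{(k)}_i` with a deep `L^i`-cube index (depth `ϱ₀ = r_0M_0`), a window `W ≤ ϱ₀L^i`,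
`W ≤ (ϱ−1)L^{i+1}` (for `□^{(5)}` of (126): `W = 6r_1M_0L^i`), `1 ≤ i < k`, `0 ≤ η`: for every `y` with
`|y_μ − x_μ| ≤ W ∀μ`,  `(η∕2)L^{k−(i+1)}·min(supDist x y, W) ≤ d_Λ(x,y) ≤ ηL^{k−i}·supDist x y`.
[cite: Dimock2004QED3TorusII, §3.2 proof of Lemma 2 Part III (177) p.27 L61–65] -/
theorem dimock177_deep (hblock : ∀ j < k, IsBlockUnion a (Λ j)) (hdec : ∀ j < k, Λ (j + 1) ⊆ unblock a (Λ j))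
    (hk : Λ k = ∅) {i : ℕ} (hi1 : 1 ≤ i) (hik : i < k) (hC : Corridor a ϱ Λ (i + 1)) {x : ι → ℤ}
    (hx : x ∈ blockUpIter a i (deltaRegion a Λ i))
    (hdeep : ∀ ω' : ι → ℤ, (∀ μ, |ω' μ - centreIter a i x μ| ≤ ϱ₀) → ω' ∈ unblock a (Λ (i - 1)))
    {W : ℕ} (hW₁ : (W : ℤ) ≤ ϱ₀ * (2 * a + 1 : ℤ) ^ i) (hW₂ : (W : ℤ) ≤ ((ϱ : ℤ) - 1) * (2 * a + 1 : ℤ) ^ (i + 1))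
    (hη : 0 ≤ η) {y : ι → ℤ} (hy : ∀ μ, |y μ - x μ| ≤ (W : ℤ)) :
    η * (2 * a + 1 : ℝ) ^ (k - (i + 1)) / 2 * ((min (supDist x y) W : ℕ) : ℝ) ≤ dLam η a Λ k x y ∧
      dLam η a Λ k x y ≤ η * (2 * a + 1 : ℝ) ^ (k - i) * supDist x y := by
  have hwin : ∀ z : ι → ℤ, (∀ μ, |z μ - x μ| ≤ (W : ℤ)) →
      z ∈ blockUpIter a i (deltaRegion a Λ i) ∨ z ∈ blockUpIter a (i + 1) (deltaRegion a Λ (i + 1)) :=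
    fun z hz => window_subset_layers_deep hblock hdec hk hi1 hik hC hx hdeep hW₁ hW₂ hz
  exact ⟨dLam_lower_of_window hblock hdec hi1 (by omega) hη hwin y,
    dLam_upper_of_window hblock hdec hi1 (by omega) hη hwin hy⟩

/-- **(177), subdivided boundary blocks of `D_i`.**  As above with `x ∈ δΛ^{(k)}_{i+1}` of shallow `L^{i+1}`-cube index
(within `ϱ₀` of a point outside `U_1Λ_i`), corridors at `i` and `i+1`, `W ≤ (ϱ−1)L^i`, `W ≤ (ϱ−ϱ₀−1)L^{i+1}`,
`1 ≤ i`, `i+1 ≤ k`. [cite: Dimock2004QED3TorusII, §3.2 proof of Lemma 2 Part III (177) p.27 L61–65] -/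
theorem dimock177_shallow (hblock : ∀ j < k, IsBlockUnion a (Λ j)) (hdec : ∀ j < k, Λ (j + 1) ⊆ unblock a (Λ j))
    (hk : Λ k = ∅) {i : ℕ} (hi1 : 1 ≤ i) (hik : i + 1 ≤ k) (hCi : Corridor a ϱ Λ i) (hC : Corridor a ϱ Λ (i + 1))
    {x : ι → ℤ} (hx : x ∈ blockUpIter a (i + 1) (deltaRegion a Λ (i + 1)))
    (hshallow : ∃ ω'' : ι → ℤ, ω'' ∉ unblock a (Λ i) ∧ ∀ μ, |ω'' μ - centreIter a (i + 1) x μ| ≤ ϱ₀)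
    {W : ℕ} (hW₁ : (W : ℤ) ≤ ((ϱ : ℤ) - 1) * (2 * a + 1 : ℤ) ^ i)
    (hW₂ : (W : ℤ) ≤ ((ϱ : ℤ) - ϱ₀ - 1) * (2 * a + 1 : ℤ) ^ (i + 1))
    (hη : 0 ≤ η) {y : ι → ℤ} (hy : ∀ μ, |y μ - x μ| ≤ (W : ℤ)) :
    η * (2 * a + 1 : ℝ) ^ (k - (i + 1)) / 2 * ((min (supDist x y) W : ℕ) : ℝ) ≤ dLam η a Λ k x y ∧
      dLam η a Λ k x y ≤ η * (2 * a + 1 : ℝ) ^ (k - i) * supDist x y := by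
  have hwin : ∀ z : ι → ℤ, (∀ μ, |z μ - x μ| ≤ (W : ℤ)) →
      z ∈ blockUpIter a i (deltaRegion a Λ i) ∨ z ∈ blockUpIter a (i + 1) (deltaRegion a Λ (i + 1)) :=
    fun z hz => window_subset_layers_shallow hblock hdec hk hi1 hik hCi hC hx hshallow hW₁ hW₂ hz
  exact ⟨dLam_lower_of_window hblock hdec hi1 hik hη hwin y, dLam_upper_of_window hblock hdec hi1 hik hη hwin hy⟩

end Dimock177

end QED3TorusII

end Literature.MathematicalPhysics.QuantumFieldTheory.Dimock2011to13
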